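import Summits.QuantumFields.YangMills.Theorems.LuscherReductionTwistedTraceScalingBOStiffCoreCoeff
import HarnessLib

/-!
# (B-ST) step (B)/(L-4), the fibrewise ground coefficient of the core piece in the lead's normalisation `Z̄ = fibreMass L (softWeight χ) Ω_c 1`
# (lane A of S-BASE, crux `TwistedTraceScaling` stmt-QuantumFields-20203, C4-CORE, the (B-ST) pen; HANDOFF-g21 STUB LEDGER (L-4))

`…BOStiffCoreCoeff.core_coeff_sq_le_mul_recordGamma` bounds the squared ground coefficient of the core piece by `a·γ(β)·n_u(v)²`, `γ = recordGamma L Ω_c β`.  The assembly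
`…BOStiffSlowAssembly.form_le_of_product_near` divides by the reference fibre mass `Z̄ = ∫ Θ²w̄ dπ` with `w̄ = softWeight χ ∘ orthoTube 1`, i.e. `Z̄ = fibreMass L (softWeight χ) Ω_c 1`;
by (B-N) `…FibreMassBrick.fibreMass_brick_record` at `u = 1` (fibres through the profile support lie in the fat tube: `…BOStiffCoreCoeff.eventually_orthoTube_one_mem_fatTube`) and (P),
`|Z̄ − γ| ≤ C_Pδ²·γ`, so `γ ≤ 2Z̄` eventually:
★★★ `core_coeff_sq_le_mul_fibreMass_one` — `∃ M₀ ≥ 2, ∀ M ≥ M₀, ∀ a > 0, ∀ᶠ β, ∀ u, ∀ v` admissible with `fibreInner … v u = 0`: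
`(∫_x v₁(oT u x)·Ω_c(x̂)·softWeight χ (oT 1 x) dπ)² ≤ a·Z̄(β)·∫_x v(oT u x)²·softWeight χ (oT u x) dπ`.  Hence `C = ∫_u (…)²/Z̄ dσ ≤ a·‖v‖²_w` for any `a > 0`.
HONEST FRAMING: bookkeeping for a stub of a child of the CONDITIONAL route R2b1; (B-ST) OPEN; C4-CORE OPEN; not infinite volume, not a gap, not Clay.
-/

set_option autoImplicit false

noncomputable section

open MeasureTheory Filter Topology Real
open scoped BigOperators
open Literature.MathematicalPhysics.QuantumFieldTheory
open Literature.MathematicalPhysics.QuantumLattice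

namespace Summit.QuantumFields.YangMills.Theorems.FemtoTransferGap.TwoLattice.ConstTube

open Summit.QuantumFields.YangMills.Theorems.FemtoTransferGap
open Summit.QuantumFields.YangMills.Theorems.FemtoTransferGap.TwoLattice
open Summit.QuantumFields.YangMills.Theorems.FemtoTransferGap.TwoLattice.Avg
open Summit.QuantumFields.YangMills.Theorems.FemtoTransferGap.TwoLattice.Stiff
open Summit.QuantumFields.YangMills.Theorems.FemtoTransferGap.TwoLattice.GnChart
open Summit.QuantumFields.YangMills.Theorems.FemtoTransferGap.TwoLattice.Cov
open Summit.QuantumFields.YangMills.Theorems.FemtoTransferGap.TwoLattice.Toron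

variable {L : ℕ} [NeZero L]

set_option maxHeartbeats 1600000 in
-- long record expressions.
/-- ★★★ **THE SAME IN THE LEAD'S NORMALISATION `Z̄ = ∫ Θ²w̄ dπ = fibreMass L (softWeight χ) Ω_c 1`**: `∃ M₀ ≥ 2, ∀ M ≥ M₀, ∀ a > 0, ∀ᶠ β, ∀ u, ∀ v` admissible with
`fibreInner … v u = 0`:  `(∫_x v₁(oT u x)·Ω_c(x̂)·softWeight χ (oT 1 x) dπ)² ≤ a·Z̄(β)·∫_x v(oT u x)²·softWeight χ (oT u x) dπ` (`Z̄ ≥ (1−C_Pδ²)γ ≥ γ/2` by (B-N)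
`…FibreMassBrick.fibreMass_brick_record` at `u = 1`). [cite: Luscher1983, §3] -/
theorem core_coeff_sq_le_mul_fibreMass_one (hLz : Nonempty (NzSite L)) (hL : 2 ≤ L) {s : ℝ} (hs : 0 < s) (hs3 : s ≤ 1 / 3) :
    ∃ M₀ : ℝ, 2 ≤ M₀ ∧ ∀ M : ℝ, M₀ ≤ M → ∀ a : ℝ, 0 < a → ∀ᶠ β : ℝ in atTop, ∀ u : GaugeConfig 3 1 SU2,
      ∀ v : GaugeConfig 3 L SU2 → ℝ, Measurable v → (∃ C : ℝ, ∀ U, |v U| ≤ C) → (∀ U, v U ≠ 0 → recordChi L s 43 M β U ≠ 0) →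
        fibreInner L (softWeight (recordChi L s 43 M β)) (fun x : LinkSpace L => {x : LinkSpace L | linkCurry x ∈ capBalancedSet L}.indicator (fun _ => (1 : ℝ)) x *
          frozenProfile L (fun β' => stiffGaussExp L (β' / 2) β') (fun β' => min (1 / 40) (powScale (1 / 2) β' * btLog β')) β x) v u = 0 →
        (∫ x, ({U : GaugeConfig 3 L SU2 | powScale 1 β * btLog β < ‖(gaugeModes L).starProjection (relLinkVec L U)‖} ∪
                  {U : GaugeConfig 3 L SU2 | min (1 / 40) (powScale (1 / 2) β * btLog β) / 2 < ‖relLinkVec L U‖})ᶜ.indicator v (orthoTube L u x) *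
              ({x : LinkSpace L | linkCurry x ∈ capBalancedSet L}.indicator (fun _ => (1 : ℝ)) (linkEmbed L x) *
                frozenProfile L (fun β' => stiffGaussExp L (β' / 2) β') (fun β' => min (1 / 40) (powScale (1 / 2) β' * btLog β')) β (linkEmbed L x)) *
              softWeight (recordChi L s 43 M β) (orthoTube L 1 x) ∂orthoTransverse L) ^ 2 ≤
          a * fibreMass L (softWeight (recordChi L s 43 M β)) (fun x : LinkSpace L => {x : LinkSpace L | linkCurry x ∈ capBalancedSet L}.indicator (fun _ => (1 : ℝ)) x *
              frozenProfile L (fun β' => stiffGaussExp L (β' / 2) β') (fun β' => min (1 / 40) (powScale (1 / 2) β' * btLog β')) β x) 1 *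
            ∫ x, v (orthoTube L u x) ^ 2 * softWeight (recordChi L s 43 M β) (orthoTube L u x) ∂orthoTransverse L := by
  -- (P) once more, for the lower fibre-mass bound at `u = 1`
  have hδ0 : ∀ β, 0 < 43 * powScale s β := fun β => mul_pos (by norm_num) (powScale_pos s β)
  have hδ : Tendsto (fun β => 43 * powScale s β) atTop (𝓝 0) := by simpa using (tendsto_powScale hs).const_mul 43
  have hsd1 : ∀ᶠ β in atTop, 0 < powScale 1 β ∧ powScale 1 β ≤ (43 * powScale s β) ^ 3 := by
    filter_upwards [eventually_ge_atTop (1 : ℝ)] with β hβ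
    have hp := powScale_pos 1 β
    have h1 : powScale 1 β ≤ powScale s β ^ 3 := powScale_one_le_cube hs3 hβ
    have hps0 : 0 ≤ powScale s β ^ 3 := pow_nonneg (powScale_pos s β).le 3
    refine ⟨hp, h1.trans ?_⟩
    calc powScale s β ^ 3 = 1 * powScale s β ^ 3 := (one_mul _).symm
      _ ≤ 43 ^ 3 * powScale s β ^ 3 := mul_le_mul_of_nonneg_right (by norm_num) hps0
      _ = (43 * powScale s β) ^ 3 := by ring
  obtain ⟨M₁, hM₁, H₁⟩ := fpWeight_core_constant L hLz hδ0 hδ hsd1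
  obtain ⟨M₂, hM₂, H₂⟩ := core_coeff_sq_le_mul_recordGamma (L := L) hLz hL hs hs3
  refine ⟨max M₁ M₂, le_max_of_le_left hM₁, fun M hM a ha => ?_⟩
  have hM2 : 2 ≤ M := hM₁.trans ((le_max_left _ _).trans hM)
  obtain ⟨C, β₀, hC, hP⟩ := H₁ M ((le_max_left _ _).trans hM)
  have hδ2 : Tendsto (fun β => (43 * powScale s β) ^ 2) atTop (𝓝 0) := by simpa using hδ.pow 2
  filter_upwards [eventually_ge_atTop β₀, eventually_mul_le_of_tendsto hδ2 C (by norm_num : (0 : ℝ) < 1 / 2),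
    H₂ M ((le_max_right _ _).trans hM) (a / 2) (by positivity), eventually_orthoTube_one_mem_fatTube (L := L) hs (by linarith) hM2]
    with β hβ0 hCδ hcore hgeo u v hv hCb hsupp horth
  have h := hcore u v hv hCb hsupp horth
  refine h.trans ?_
  -- `γ ≤ Z̄/(1−κ) ≤ 2Z̄`
  set κ : ℝ := C * (43 * powScale s β) ^ 2 with hκdef
  have hκ0 : 0 ≤ κ := by positivity
  have hqfm : ∀ β', Measurable ((fun β'' : ℝ => stiffGaussExp L (β'' / 2) β'') β') := fun β' => measurable_stiffGaussExp _ _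
  have hqf0 : ∀ β' x, 0 ≤ (fun β'' : ℝ => stiffGaussExp L (β'' / 2) β'') β' x := fun β' x => stiffGaussExp_nonneg _ _ x
  have hΩGm : Measurable (frozenProfile L (fun β' => stiffGaussExp L (β' / 2) β') (fun β' => min (1 / 40) (powScale (1 / 2) β' * btLog β')) β) :=
    measurable_frozenProfile hqfm _ β
  have hΩG0 : ∀ x, 0 ≤ frozenProfile L (fun β' => stiffGaussExp L (β' / 2) β') (fun β' => min (1 / 40) (powScale (1 / 2) β' * btLog β')) β x :=
    fun x => (frozenProfile_mem_Icc hqf0 _ β x).1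
  have hΩG1 : ∀ x, |frozenProfile L (fun β' => stiffGaussExp L (β' / 2) β') (fun β' => min (1 / 40) (powScale (1 / 2) β' * btLog β')) β x| ≤ 1 :=
    abs_frozenProfile_le hqf0 _ β
  have hΩm := measurable_capRestrict (L := L) hΩGm
  have hΩ1 : ∀ x, |{x : LinkSpace L | linkCurry x ∈ capBalancedSet L}.indicator (fun _ => (1 : ℝ)) x *
      frozenProfile L (fun β' => stiffGaussExp L (β' / 2) β') (fun β' => min (1 / 40) (powScale (1 / 2) β' * btLog β')) β x| ≤ 1 :=
    fun x => (capRestrict_mem (L := L) hΩG0 hΩG1 x).2.2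
  have hΩR : ∀ x, {x : LinkSpace L | linkCurry x ∈ capBalancedSet L}.indicator (fun _ => (1 : ℝ)) x *
      frozenProfile L (fun β' => stiffGaussExp L (β' / 2) β') (fun β' => min (1 / 40) (powScale (1 / 2) β' * btLog β')) β x ≠ 0 →
      ‖x‖ ≤ min (1 / 40) (powScale (1 / 2) β * btLog β) := fun x hx => norm_le_of_frozenProfile_ne_zero _ _ β (right_ne_zero_of_mul hx)
  have hP' : ∀ U ∈ fatTubeRho L (fun β : ℝ => 43 * powScale s β) (fun b => M * (43 * powScale s b)) β,
      fpWeightBar L (powScale 1 β) * (1 - κ) ≤ gaugeAvg (recordWeightRho L (fun β : ℝ => 43 * powScale s β) (fun b => M * (43 * powScale s b)) (powScale 1) β) U ∧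
      gaugeAvg (recordWeightRho L (fun β : ℝ => 43 * powScale s β) (fun b => M * (43 * powScale s b)) (powScale 1) β) U ≤ fpWeightBar L (powScale 1 β) * (1 + κ) :=
    fun U hU => hP β hβ0 U hU
  have hb := fibreMass_brick_record (L := L) (fun β : ℝ => 43 * powScale s β) (fun b => M * (43 * powScale s b)) (powScale 1) β hP' hΩm hΩ1 hΩR
    (u := 1) (fun x _ hx => hgeo x hx)
  set γ := recordGamma L (fun β' => fun x : LinkSpace L => {x : LinkSpace L | linkCurry x ∈ capBalancedSet L}.indicator (fun _ => (1 : ℝ)) x *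
      frozenProfile L (fun β'' => stiffGaussExp L (β'' / 2) β'') (fun β'' => min (1 / 40) (powScale (1 / 2) β'' * btLog β'')) β' x) β with hγdef
  set Z := fibreMass L (softWeight (recordChi L s 43 M β)) (fun x : LinkSpace L => {x : LinkSpace L | linkCurry x ∈ capBalancedSet L}.indicator (fun _ => (1 : ℝ)) x *
      frozenProfile L (fun β' => stiffGaussExp L (β' / 2) β') (fun β' => min (1 / 40) (powScale (1 / 2) β' * btLog β')) β x) 1 with hZdef
  have hbZ : |Z - γ| ≤ κ * γ := hb
  have hγ0 : 0 ≤ γ := by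
    rw [hγdef]; unfold recordGamma boGamma
    exact mul_nonneg (fpWeightBar_pos L (powScale_pos 1 β)).le (integral_nonneg fun v => mul_nonneg (sq_nonneg _) (Real.exp_pos _).le)
  have hγZ : γ ≤ 2 * Z := by
    have h1 := (abs_le.mp hbZ).1
    nlinarith
  have hN0 : 0 ≤ ∫ x, v (orthoTube L u x) ^ 2 * softWeight (recordChi L s 43 M β) (orthoTube L u x) ∂orthoTransverse L :=
    integral_nonneg fun x => mul_nonneg (sq_nonneg _) ((softWeight_recordChi_props (L := L) s 43 M β).2.2.1 _)
  calc a / 2 * γ * ∫ x, v (orthoTube L u x) ^ 2 * softWeight (recordChi L s 43 M β) (orthoTube L u x) ∂orthoTransverse L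
      ≤ a / 2 * (2 * Z) * ∫ x, v (orthoTube L u x) ^ 2 * softWeight (recordChi L s 43 M β) (orthoTube L u x) ∂orthoTransverse L :=
        mul_le_mul_of_nonneg_right (mul_le_mul_of_nonneg_left hγZ (by positivity)) hN0
    _ = a * Z * ∫ x, v (orthoTube L u x) ^ 2 * softWeight (recordChi L s 43 M β) (orthoTube L u x) ∂orthoTransverse L := by ring

end Summit.QuantumFields.YangMills.Theorems.FemtoTransferGap.TwoLattice.ConstTube

end
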